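import Summits.CriticalPhenomena.PercolationContinuityZ3.Theorems.PercGamblersRuinVerticalGamblersRuinStubStationarity

/-!
# Route `PercGamblersRuin`, crux `VerticalGamblersRuin` (stmt-CriticalPhenomena-10642):
# kernel algebra for the deterministic-time criterion (line `registered`, skeleton rev 7)

Helper file (lead c3) for the deterministic-time criterion (DTC) of the line `registered` of the crux
`PercGamblersRuin.VerticalGamblersRuin` (stmt-CriticalPhenomena-10642); the criterion itself is proved in
`Theorems/PercGamblersRuinVerticalGamblersRuinDeterministicTime.lean`.

Objects.  For a bond configuration `ω` on `ℤ³` let `N_ω(x)` be the open lattice neighbours of `x`,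
`deg_ω(x) = #N_ω(x)`, `𝒫_ω f x := (∑_{y ∈ N_ω(x)} f y) / deg_ω(x)` the one-step averaging operator of the
simple random walk on the open cluster (`0/0 = 0`: the walk dies at a site without open neighbour), and,
for a killing region `ins` (here an open slab `{-M < x₀ < M}`), `𝒦_ω f x := if ins x then 𝒫_ω f x else 0`
the operator KILLED outside `ins`; so `(𝒦_ω^T f)(x) = E^ω_x[f(X_T); X_0, …, X_{T-1} ∈ ins]`.  As in the
sibling files NO definitions are introduced: the operators enter every lemma as functions pinned by a
hypothesis giving their formula (`hΦ`, `hΨ`), the iterates are Mathlib's `Nat.iterate`.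

Contents (all elementary, [folklore]; Lyons–Peres 2016 §2.1 for the potential-theoretic reading):
monotonicity, `[0,1]`-preservation and linearity of `𝒦`, `𝒦^T ≤ 𝒫^T` on nonnegative functions, the
super-fixed-point property `𝒦 u ≤ u` of a nonnegative function harmonic on the killing region and its
consequence `𝒦^T f ≤ u` for `f ≤ u` ("a harmonic function dominates the killed iterates":
`u(0) = (𝒬^T u)(0) ≥ (𝒦^T f)(0)` for the stopped kernel `𝒬 ≥ 𝒦`), measurability in `ω` of the iterates
applied to configuration-dependent functions, the degree bound `deg ≤ 6` and `deg ≥ 1` a.s. on `{0 ↔ ∞}`.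

## References
* R. Lyons, Y. Peres, *Probability on Trees and Networks*, CUP (2016), §2.1.
* G. Grimmett, *Percolation*, 2nd ed., Springer (1999), §1.3–1.4.
-/

noncomputable section

namespace Summit.CriticalPhenomena.PercolationContinuityZ3.Theorems.VerticalGamblersRuin

open MeasureTheory Filter Topology
open Literature.Probability.Percolation Literature.Probability.LatticeModels
open scoped Classical

namespace DeterministicTime

/-! ### Kernel algebra for the killed / unkilled averaging operators -/

section Kernel

variable {V : Type*} {N : V → Finset V} {ins : V → Prop} [DecidablePred ins]
  {Φ Ψ : (V → ℝ) → V → ℝ}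

/-- The killed averaging operator is monotone. [folklore] -/
theorem killed_mono
    (hΦ : ∀ f x, Φ f x = if ins x then (∑ y ∈ N x, f y) / ((N x).card : ℝ) else 0)
    {f g : V → ℝ} (hfg : ∀ x, f x ≤ g x) (x : V) : Φ f x ≤ Φ g x := by
  rw [hΦ, hΦ]
  split_ifs
  · exact div_le_div_of_nonneg_right (Finset.sum_le_sum fun y _ => hfg y) (Nat.cast_nonneg _)
  · exact le_rfl

/-- Iterates of the killed operator are monotone. [folklore] -/
theorem killed_iterate_mono
    (hΦ : ∀ f x, Φ f x = if ins x then (∑ y ∈ N x, f y) / ((N x).card : ℝ) else 0)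
    (T : ℕ) : ∀ {f g : V → ℝ}, (∀ x, f x ≤ g x) → ∀ x, (Φ^[T] f) x ≤ (Φ^[T] g) x := by
  induction T with
  | zero => intro f g hfg x; simpa using hfg x
  | succ T ih =>
    intro f g hfg x
    rw [Function.iterate_succ_apply, Function.iterate_succ_apply]
    exact ih (fun y => killed_mono hΦ hfg y) x

/-- The killed operator preserves `[0,1]`-valued functions. [folklore] -/
theorem killed_mem_Icc
    (hΦ : ∀ f x, Φ f x = if ins x then (∑ y ∈ N x, f y) / ((N x).card : ℝ) else 0)
    {f : V → ℝ} (hf : ∀ x, 0 ≤ f x ∧ f x ≤ 1) (x : V) : 0 ≤ Φ f x ∧ Φ f x ≤ 1 := by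
  rw [hΦ]
  split_ifs
  · refine ⟨div_nonneg (Finset.sum_nonneg fun y _ => (hf y).1) (Nat.cast_nonneg _), ?_⟩
    refine div_le_one_of_le₀ ?_ (Nat.cast_nonneg _)
    calc ∑ y ∈ N x, f y ≤ ∑ _y ∈ N x, (1 : ℝ) := Finset.sum_le_sum fun y _ => (hf y).2
      _ = ((N x).card : ℝ) := by rw [Finset.sum_const, nsmul_eq_mul, mul_one]
  · exact ⟨le_rfl, zero_le_one⟩

/-- The unkilled operator preserves `[0,1]`-valued functions. [folklore] -/
theorem full_mem_Icc
    (hΨ : ∀ f x, Ψ f x = (∑ y ∈ N x, f y) / ((N x).card : ℝ))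
    {f : V → ℝ} (hf : ∀ x, 0 ≤ f x ∧ f x ≤ 1) (x : V) : 0 ≤ Ψ f x ∧ Ψ f x ≤ 1 := by
  rw [hΨ]
  refine ⟨div_nonneg (Finset.sum_nonneg fun y _ => (hf y).1) (Nat.cast_nonneg _), ?_⟩
  refine div_le_one_of_le₀ ?_ (Nat.cast_nonneg _)
  calc ∑ y ∈ N x, f y ≤ ∑ _y ∈ N x, (1 : ℝ) := Finset.sum_le_sum fun y _ => (hf y).2
    _ = ((N x).card : ℝ) := by rw [Finset.sum_const, nsmul_eq_mul, mul_one]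

/-- Iterates of the killed operator preserve `[0,1]`-valued functions. [folklore] -/
theorem killed_iterate_mem_Icc
    (hΦ : ∀ f x, Φ f x = if ins x then (∑ y ∈ N x, f y) / ((N x).card : ℝ) else 0)
    (T : ℕ) : ∀ {f : V → ℝ}, (∀ x, 0 ≤ f x ∧ f x ≤ 1) → ∀ x, 0 ≤ (Φ^[T] f) x ∧ (Φ^[T] f) x ≤ 1 := by
  induction T with
  | zero => intro f hf x; simpa using hf x
  | succ T ih =>
    intro f hf x
    rw [Function.iterate_succ_apply]
    exact ih (fun y => killed_mem_Icc hΦ hf y) x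

/-- Iterates of the unkilled operator preserve `[0,1]`-valued functions. [folklore] -/
theorem full_iterate_mem_Icc
    (hΨ : ∀ f x, Ψ f x = (∑ y ∈ N x, f y) / ((N x).card : ℝ))
    (T : ℕ) : ∀ {f : V → ℝ}, (∀ x, 0 ≤ f x ∧ f x ≤ 1) → ∀ x, 0 ≤ (Ψ^[T] f) x ∧ (Ψ^[T] f) x ≤ 1 := by
  induction T with
  | zero => intro f hf x; simpa using hf x
  | succ T ih =>
    intro f hf x
    rw [Function.iterate_succ_apply]
    exact ih (fun y => full_mem_Icc hΨ hf y) x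

/-- The killed operator is additive-subtractive: `Φ (f - g) = Φ f - Φ g`. [folklore] -/
theorem killed_sub
    (hΦ : ∀ f x, Φ f x = if ins x then (∑ y ∈ N x, f y) / ((N x).card : ℝ) else 0)
    (f g : V → ℝ) : (Φ fun y => f y - g y) = fun x => Φ f x - Φ g x := by
  funext x
  rw [hΦ, hΦ, hΦ]
  split_ifs
  · rw [Finset.sum_sub_distrib, sub_div]
  · rw [sub_zero]

/-- Iterates of the killed operator are subtractive. [folklore] -/
theorem killed_iterate_sub
    (hΦ : ∀ f x, Φ f x = if ins x then (∑ y ∈ N x, f y) / ((N x).card : ℝ) else 0)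
    (T : ℕ) : ∀ f g : V → ℝ, (Φ^[T] fun y => f y - g y) = fun x => (Φ^[T] f) x - (Φ^[T] g) x := by
  induction T with
  | zero => intro f g; rfl
  | succ T ih =>
    intro f g
    rw [Function.iterate_succ_apply, Function.iterate_succ_apply, Function.iterate_succ_apply,
      killed_sub hΦ, ih]

/-- On nonnegative functions the killed operator lies below the unkilled one. [folklore] -/
theorem killed_le_full
    (hΦ : ∀ f x, Φ f x = if ins x then (∑ y ∈ N x, f y) / ((N x).card : ℝ) else 0)
    (hΨ : ∀ f x, Ψ f x = (∑ y ∈ N x, f y) / ((N x).card : ℝ))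
    {f : V → ℝ} (hf : ∀ x, 0 ≤ f x) (x : V) : Φ f x ≤ Ψ f x := by
  rw [hΦ, hΨ]
  split_ifs
  · exact le_rfl
  · exact div_nonneg (Finset.sum_nonneg fun y _ => hf y) (Nat.cast_nonneg _)

/-- On nonnegative functions the iterates of the killed operator lie below those of the unkilled
one. [folklore] -/
theorem killed_iterate_le_full
    (hΦ : ∀ f x, Φ f x = if ins x then (∑ y ∈ N x, f y) / ((N x).card : ℝ) else 0)
    (hΨ : ∀ f x, Ψ f x = (∑ y ∈ N x, f y) / ((N x).card : ℝ))
    (T : ℕ) : ∀ {f : V → ℝ}, (∀ x, 0 ≤ f x) → ∀ x, (Φ^[T] f) x ≤ (Ψ^[T] f) x := by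
  induction T with
  | zero => intro f hf x; simp
  | succ T ih =>
    intro f hf x
    rw [Function.iterate_succ_apply, Function.iterate_succ_apply]
    have hΨf : ∀ y, 0 ≤ Ψ f y := fun y => by
      rw [hΨ]
      exact div_nonneg (Finset.sum_nonneg fun z _ => hf z) (Nat.cast_nonneg _)
    calc (Φ^[T] (Φ f)) x ≤ (Φ^[T] (Ψ f)) x :=
          killed_iterate_mono hΦ T (fun y => killed_le_full hΦ hΨ hf y) x
      _ ≤ (Ψ^[T] (Ψ f)) x := ih hΨf x

/-- A nonnegative function harmonic on the killing region is a super-fixed-point of the killed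
operator. [folklore] -/
theorem killed_le_of_harmonic
    (hΦ : ∀ f x, Φ f x = if ins x then (∑ y ∈ N x, f y) / ((N x).card : ℝ) else 0)
    {u : V → ℝ} (hu0 : ∀ x, 0 ≤ u x) (hharm : ∀ x, ins x → ∑ y ∈ N x, (u y - u x) = 0) (x : V) :
    Φ u x ≤ u x := by
  rw [hΦ]
  split_ifs with hx
  · have h := hharm x hx
    rw [Finset.sum_sub_distrib, Finset.sum_const, nsmul_eq_mul, sub_eq_zero] at h
    rw [h]
    rcases eq_or_ne ((N x).card : ℝ) 0 with hc | hc
    · rw [hc, zero_mul, zero_div]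
      exact hu0 x
    · rw [mul_div_cancel_left₀ _ hc]
  · exact hu0 x

/-- **Harmonic functions dominate the killed iterates** (`u(0) = (𝒬^T u)(0) ≥ (𝒦^T f)(0)` for the
stopped kernel `𝒬 ≥ 𝒦` and `f ≤ u`): if `u ≥ 0` is harmonic on the killing region and `f ≤ u`, then
`Φ^[T] f ≤ u`. [folklore] -/
theorem killed_iterate_le_of_harmonic
    (hΦ : ∀ f x, Φ f x = if ins x then (∑ y ∈ N x, f y) / ((N x).card : ℝ) else 0)
    {u : V → ℝ} (hu0 : ∀ x, 0 ≤ u x) (hharm : ∀ x, ins x → ∑ y ∈ N x, (u y - u x) = 0)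
    (T : ℕ) {f : V → ℝ} (hf : ∀ x, f x ≤ u x) (x : V) : (Φ^[T] f) x ≤ u x := by
  induction T generalizing x with
  | zero => simpa using hf x
  | succ T ih =>
    rw [Function.iterate_succ_apply']
    exact (killed_mono hΦ ih x).trans (killed_le_of_harmonic hΦ hu0 hharm x)

end Kernel

/-! ### The lattice part: measurability, degree bounds -/

/-- Measurability in the configuration of the iterates of the KILLED operator applied to a
configuration-dependent function measurable at every site. [folklore] -/
theorem measurable_killed_iterate {ins : Site 3 → Prop} [DecidablePred ins]
    {F : BondConfig (Site 3) → Site 3 → ℝ} (hF : ∀ x, Measurable fun ω => F ω x)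
    {Φ : BondConfig (Site 3) → (Site 3 → ℝ) → Site 3 → ℝ}
    (hΦ : ∀ ω f x, Φ ω f x = if ins x then
      (∑ y ∈ ((zdGraph 3).neighborFinset x).filter (fun y => s(x, y) ∈ ω), f y) /
        ((((zdGraph 3).neighborFinset x).filter (fun y => s(x, y) ∈ ω)).card : ℝ) else 0)
    (T : ℕ) : ∀ x, Measurable fun ω => ((Φ ω)^[T] (F ω)) x := by
  -- adapted from Theorems/PercGamblersRuinVerticalGamblersRuinStubMinimalSolution.lean (`measurable_iterate`)
  induction T with
  | zero => intro x; simpa using hF x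
  | succ T ih =>
    intro x
    simp only [Function.iterate_succ_apply', hΦ]
    by_cases h1 : ins x
    · simp only [if_pos h1]
      refine Measurable.div ?_ ?_
      · have : (fun ω : BondConfig (Site 3) =>
            ∑ y ∈ ((zdGraph 3).neighborFinset x).filter (fun y => s(x, y) ∈ ω),
              ((Φ ω)^[T] (F ω)) y) =
            fun ω => ∑ y ∈ (zdGraph 3).neighborFinset x,
              if s(x, y) ∈ ω then ((Φ ω)^[T] (F ω)) y else 0 := by
          funext ω
          rw [Finset.sum_filter]
        rw [this]
        refine Finset.measurable_sum _ fun y _ => ?_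
        exact Measurable.ite (measurableSet_mem (s(x, y) : Sym2 (Site 3))) (ih y) measurable_const
      · have : (fun ω : BondConfig (Site 3) =>
            ((((zdGraph 3).neighborFinset x).filter (fun y => s(x, y) ∈ ω)).card : ℝ)) =
            fun ω => ∑ y ∈ (zdGraph 3).neighborFinset x, if s(x, y) ∈ ω then (1 : ℝ) else 0 := by
          funext ω
          rw [Finset.card_filter, Nat.cast_sum]
          refine Finset.sum_congr rfl fun y _ => ?_
          split_ifs <;> simp
        rw [this]
        refine Finset.measurable_sum _ fun y _ => ?_
        exact Measurable.ite (measurableSet_mem (s(x, y) : Sym2 (Site 3))) measurable_const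
          measurable_const
    · simp only [if_neg h1]
      exact measurable_const

/-- Measurability in the configuration of the iterates of the UNKILLED operator applied to a
configuration-dependent function measurable at every site. [folklore] -/
theorem measurable_full_iterate
    {F : BondConfig (Site 3) → Site 3 → ℝ} (hF : ∀ x, Measurable fun ω => F ω x)
    {Ψ : BondConfig (Site 3) → (Site 3 → ℝ) → Site 3 → ℝ}
    (hΨ : ∀ ω f x, Ψ ω f x =
      (∑ y ∈ ((zdGraph 3).neighborFinset x).filter (fun y => s(x, y) ∈ ω), f y) /
        ((((zdGraph 3).neighborFinset x).filter (fun y => s(x, y) ∈ ω)).card : ℝ))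
    (T : ℕ) : ∀ x, Measurable fun ω => ((Ψ ω)^[T] (F ω)) x := by
  induction T with
  | zero => intro x; simpa using hF x
  | succ T ih =>
    intro x
    simp only [Function.iterate_succ_apply', hΨ]
    refine Measurable.div ?_ ?_
    · have : (fun ω : BondConfig (Site 3) =>
          ∑ y ∈ ((zdGraph 3).neighborFinset x).filter (fun y => s(x, y) ∈ ω),
            ((Ψ ω)^[T] (F ω)) y) =
          fun ω => ∑ y ∈ (zdGraph 3).neighborFinset x,
            if s(x, y) ∈ ω then ((Ψ ω)^[T] (F ω)) y else 0 := by
        funext ω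
        rw [Finset.sum_filter]
      rw [this]
      refine Finset.measurable_sum _ fun y _ => ?_
      exact Measurable.ite (measurableSet_mem (s(x, y) : Sym2 (Site 3))) (ih y) measurable_const
    · have : (fun ω : BondConfig (Site 3) =>
          ((((zdGraph 3).neighborFinset x).filter (fun y => s(x, y) ∈ ω)).card : ℝ)) =
          fun ω => ∑ y ∈ (zdGraph 3).neighborFinset x, if s(x, y) ∈ ω then (1 : ℝ) else 0 := by
        funext ω
        rw [Finset.card_filter, Nat.cast_sum]
        refine Finset.sum_congr rfl fun y _ => ?_
        split_ifs <;> simp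
      rw [this]
      refine Finset.measurable_sum _ fun y _ => ?_
      exact Measurable.ite (measurableSet_mem (s(x, y) : Sym2 (Site 3))) measurable_const
        measurable_const

/-- The open degree of a site is a measurable function of the configuration. [folklore] -/
theorem measurable_deg (x : Site 3) :
    Measurable fun ω : BondConfig (Site 3) =>
      ((((zdGraph 3).neighborFinset x).filter (fun y => s(x, y) ∈ ω)).card : ℝ) := by
  have : (fun ω : BondConfig (Site 3) =>
      ((((zdGraph 3).neighborFinset x).filter (fun y => s(x, y) ∈ ω)).card : ℝ)) =
      fun ω => ∑ y ∈ (zdGraph 3).neighborFinset x, if s(x, y) ∈ ω then (1 : ℝ) else 0 := by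
    funext ω
    rw [Finset.card_filter, Nat.cast_sum]
    refine Finset.sum_congr rfl fun y _ => ?_
    split_ifs <;> simp
  rw [this]
  refine Finset.measurable_sum _ fun y _ => ?_
  exact Measurable.ite (measurableSet_mem (s(x, y) : Sym2 (Site 3))) measurable_const measurable_const

/-- The open degree is at most `6 = 2·3` (`card_neighborFinset_zdGraph_holds`). [folklore] -/
theorem deg_le_six (ω : BondConfig (Site 3)) (x : Site 3) :
    ((((zdGraph 3).neighborFinset x).filter (fun y => s(x, y) ∈ ω)).card : ℝ) ≤ 6 := by
  have h1 : (((zdGraph 3).neighborFinset x).filter (fun y => s(x, y) ∈ ω)).card ≤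
      ((zdGraph 3).neighborFinset x).card := Finset.card_filter_le _ _
  have h2 : ((zdGraph 3).neighborFinset x).card = 2 * 3 := card_neighborFinset_zdGraph_holds x
  have h3 : (((zdGraph 3).neighborFinset x).filter (fun y => s(x, y) ∈ ω)).card ≤ 6 := by omega
  exact_mod_cast h3

/-- On `{0 ↔ ∞}`, almost surely, the origin has an open lattice neighbour (a.s. `ω ⊆ E(ℤ³)`, and the
first edge of an open path from `0` to a point `≠ 0` of its infinite cluster is a lattice edge).
[folklore] -/
theorem one_le_deg_ae :
    ∀ᵐ ω ∂(bondPercolation (zdGraph 3) (criticalProbI 3)), ω ∈ percolatesAt (0 : Site 3) →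
      (1 : ℝ) ≤ ((((zdGraph 3).neighborFinset (0 : Site 3)).filter
        (fun y => s((0 : Site 3), y) ∈ ω)).card : ℝ) := by
  have h1 : ∀ᵐ ω ∂(bondPercolation (zdGraph 3) (criticalProbI 3)), ω ⊆ (zdGraph 3).edgeSet :=
    ProbabilityTheory.setBernoulli_ae_subset
  filter_upwards [h1] with ω hωE hperc
  have hinf : (openCluster ω (0 : Site 3)).Infinite := hperc
  obtain ⟨y, hyC, hy0⟩ : ∃ y ∈ openCluster ω (0 : Site 3), y ≠ (0 : Site 3) := by
    obtain ⟨y, hy⟩ := (hinf.sdiff (Set.finite_singleton (0 : Site 3))).nonempty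
    exact ⟨y, hy.1, hy.2⟩
  obtain ⟨p⟩ : (openGraph ω).Reachable 0 y := hyC
  obtain ⟨z, hz⟩ : ∃ z, (openGraph ω).Adj 0 z := by
    cases p with
    | nil => exact absurd rfl hy0
    | cons h _ => exact ⟨_, h⟩
  have hz' := (openGraph_adj ω 0 z).1 hz
  have hadj : (zdGraph 3).Adj 0 z := by
    have := hωE hz'.1
    simpa using this
  have hmem : z ∈ ((zdGraph 3).neighborFinset (0 : Site 3)).filter
      (fun y => s((0 : Site 3), y) ∈ ω) := by
    rw [Finset.mem_filter, SimpleGraph.mem_neighborFinset]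
    exact ⟨hadj, hz'.1⟩
  have hpos : 1 ≤ (((zdGraph 3).neighborFinset (0 : Site 3)).filter
      (fun y => s((0 : Site 3), y) ∈ ω)).card := Finset.card_pos.2 ⟨z, hmem⟩
  exact_mod_cast hpos

end DeterministicTime

open DeterministicTime in
/-- **stub `stub_harmonicDominatesKilled`** of line `registered` (rev 7; exact registered signature): a
nonnegative function `u` on `ℤ³`, harmonic for the open lattice edges of `ω` at every site of the open
slab `(-Kn, Kn)`, dominates every iterate `𝒦_ω^T f` of the SRW averaging operator killed outside that
slab applied to any `f ≤ u` — step (a) of the deterministic-time criterion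
(`u(0) = (𝒬^T u)(0) ≥ (𝒦^T f)(0)`).  [folklore; Lyons–Peres 2016 §2.1] -/
theorem stub_harmonicDominatesKilled :
    ∀ (K n T : ℕ) (Kop : BondConfig (Site 3) → (Site 3 → ℝ) → Site 3 → ℝ),
      (∀ ω (g : Site 3 → ℝ) (x : Site 3), Kop ω g x =
        if -((K * n : ℕ) : ℤ) < x 0 ∧ x 0 < ((K * n : ℕ) : ℤ) then
          (∑ y ∈ ((zdGraph 3).neighborFinset x).filter (fun y => s(x, y) ∈ ω), g y) /
            ((((zdGraph 3).neighborFinset x).filter (fun y => s(x, y) ∈ ω)).card : ℝ)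
        else 0) →
      ∀ (ω : BondConfig (Site 3)) (u : Site 3 → ℝ), (∀ x, 0 ≤ u x) →
        (∀ x : Site 3, -((K * n : ℕ) : ℤ) < x 0 → x 0 < ((K * n : ℕ) : ℤ) →
          ∑ y ∈ ((zdGraph 3).neighborFinset x).filter (fun y => s(x, y) ∈ ω), (u y - u x) = 0) →
        ∀ f : Site 3 → ℝ, (∀ x, f x ≤ u x) → ∀ x, ((Kop ω)^[T] f) x ≤ u x := by
  intro K n T Kop hKop ω u hu0 hharm f hf x
  exact killed_iterate_le_of_harmonic (hKop ω) hu0 (fun y hy => hharm y hy.1 hy.2) T hf x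

end Summit.CriticalPhenomena.PercolationContinuityZ3.Theorems.VerticalGamblersRuin

end
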